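import Mathlib
import Summits.ValiantsHypothesis.ValiantsHypothesis.Theorems.MatrixDescartes.Negative.MatrixDescartesFalseOfTropicalMonster

/-!
# Coefficients and archimedean masses of the patchworked pencil of a tropical design

HONEST FRAMING.  Helper file (part 3 of 4) toward the lifting crux `WeakLifting` (stmt-ValiantsHypothesis-19561; aside `Lifting`
stmt-ValiantsHypothesis-19772) of route `KPlusLogSqLaw` (cell `pub-symmetroid`, seat val-sym-lift-p2 g3, 2026-08-26).  Bookkeeping for the
patchworked pencil `Σ_l X^{d_l} · patchMatrix b v ε l` of a design `(d, v, ε)` at base `b` (tree vocabulary of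
`…MatrixDescartes.Negative`: `patchMatrix`, `termSign`, `tropWeight`); nothing here asserts `WeakLifting`, `TropicalB`, Conjecture B,
`MatrixDescartes` (stmt-ValiantsHypothesis-18050) or anything about VP ≠ VNP.

CONTENT (`D(p) = Σᵢ d(λᵢ)`, `V(p) = Σᵢ v(σᵢ, i, λᵢ)` for a Leibniz term `p = (σ, λ)`; `N = #terms`):
* `coeff_det_patch` / `coeff_det_patch_eq_sum_filter` — the coefficient of `X^n` in the determinant is
  `Σ_{D(p) = n} termSign(p) · b^{−V(p)}` (Leibniz expansion at polynomial level; companion of the tree's pointwise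
  `det_patch_eq_sum`);
* `weighted_mass_le_sum_terms` — for `x ≥ 0` and a weight `φ ≥ 0`, `Σ_{s ∈ T} φ(s)|a_s| x^s ≤ Σ_{D(p) ∈ T} φ(D p)|termSign p| b^{−V p} x^{D p}`
  (fibrewise regrouping);
* `abs_coeff_vertex_sub_le`, `half_le_termSign_mul_coeff` — if the present term `P` has the least valuation in its slope class (by
  `≥ 1`, integers), then `|a_{D P} − termSign(P) b^{−V P}| ≤ (N − 1) b^{−V P − 1}`, so for `b ≥ 2N` the vertex coefficient has the SIGN
  of its term and size `≥ b^{−V P}/2`;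
* `zpow_neg_mul_pow_eq`, `term_mass_eq`, `term_mass_le` — at a test point `x = b^θ ρ₀` a term's mass is `b^{tropWeight θ p} ρ₀^{D p}`, hence
  `≤ φ b^{W−1} c` for a competitor of weight `≤ W − 1` with `ρ₀^{D} ≤ c`;
* `mass_le_vertex_add`, `mass_le_of_margin` — the resulting bounds `Σ_{s∈T} φ(s)|a_s| x^s ≤ φ(D p₀) b^W ρ₀^{D p₀} + N Φ b^{W−1} c`
  (one tying vertex `p₀` of weight `W`, all other present terms of slope in `T` of weight `≤ W − 1`) and `≤ N Φ b^{W−1} c` (no vertex);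
* `exists_present_of_mem_support` — every exponent of the support is the slope of a present term.
Part 4 (`…LiftingPatchworkExact`) feeds these into the exact archimedean Newton-polygon count of parts 1–2.  No `def`.
[folklore] (quantitative one-variable patchworking).
-/

set_option linter.dupNamespace false
set_option autoImplicit false

namespace Summit.ValiantsHypothesis.ValiantsHypothesis.Theorems.KPlusLogSqLaw.ExactPatchwork

open Polynomial Finset
open scoped BigOperators
open Summit.ValiantsHypothesis.ValiantsHypothesis.Theorems.MatrixDescartes.Negative
  (patchMatrix tropWeight termSign prod_zpow_eq_zpow_sum_patch abs_termSign_eq_one)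

variable {m K : ℕ}

/-- **Leibniz–patchwork expansion at the level of coefficients.** The coefficient of `X^n` in the determinant of the
patchworked pencil at base `b > 0` is the signed sum of `termSign · b^{−V}` over the Leibniz terms `(σ, λ)` of slope
`∑ᵢ d (λ i) = n`, where `V = ∑ᵢ v (σ i) i (λ i)`. [folklore] -/
theorem coeff_det_patch (b : ℝ) (hb : 0 < b) (d : Fin K → ℕ) (v ε : Fin m → Fin m → Fin K → ℤ) (n : ℕ) :
    ((∑ l, (X : ℝ[X]) ^ d l • (patchMatrix b v ε l).map C).det).coeff n =
      ∑ p : Equiv.Perm (Fin m) × (Fin m → Fin K),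
        if (∑ i, d (p.2 i)) = n then (termSign ε p : ℝ) * b ^ (-(∑ i, v (p.1 i) i (p.2 i))) else 0 := by
  classical
  have hb0 : b ≠ 0 := ne_of_gt hb
  have hentry : ∀ (i j : Fin m), (∑ l, (X : ℝ[X]) ^ d l • (patchMatrix b v ε l).map C) i j
      = ∑ l, C ((ε i j l : ℝ) * b ^ (-(v i j l))) * X ^ d l := by
    intro i j
    simp only [Matrix.sum_apply, Matrix.smul_apply, Matrix.map_apply, patchMatrix, smul_eq_mul]
    exact Finset.sum_congr rfl fun l _ => by ring
  rw [Matrix.det_apply', ← Finset.univ_product_univ, Finset.sum_product, finsetSum_coeff]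
  refine Finset.sum_congr rfl fun σ _ => ?_
  simp_rw [hentry]
  rw [Fintype.prod_sum, Finset.mul_sum, finsetSum_coeff]
  refine Finset.sum_congr rfl fun f _ => ?_
  have hprod : ∏ i, C ((ε (σ i) i (f i) : ℝ) * b ^ (-(v (σ i) i (f i)))) * (X : ℝ[X]) ^ d (f i)
      = C (∏ i, ((ε (σ i) i (f i) : ℝ) * b ^ (-(v (σ i) i (f i))))) * X ^ (∑ i, d (f i)) := by
    rw [Finset.prod_mul_distrib, Finset.prod_pow_eq_pow_sum, map_prod]
  rw [hprod]
  have hsign : ((Equiv.Perm.sign σ : ℤ) : ℝ[X]) = C ((Equiv.Perm.sign σ : ℤ) : ℝ) := by simp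
  rw [hsign, ← mul_assoc, ← C_mul, coeff_C_mul_X_pow]
  by_cases h : (∑ i, d (f i)) = n
  · rw [if_pos h.symm, if_pos h]
    simp only [termSign, Int.cast_mul, Int.cast_prod]
    rw [Finset.prod_mul_distrib, prod_zpow_eq_zpow_sum_patch _ _ hb0, Finset.sum_neg_distrib]
    ring
  · rw [if_neg (fun h' => h h'.symm), if_neg h]


/-- the coefficient of `X^n` as a sum over the slope-`n` fibre of Leibniz terms. [folklore] -/
theorem coeff_det_patch_eq_sum_filter (b : ℝ) (hb : 0 < b) (d : Fin K → ℕ) (v ε : Fin m → Fin m → Fin K → ℤ) (n : ℕ) :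
    ((∑ l, (X : ℝ[X]) ^ d l • (patchMatrix b v ε l).map C).det).coeff n =
      ∑ p ∈ (Finset.univ : Finset (Equiv.Perm (Fin m) × (Fin m → Fin K))).filter (fun p => (∑ i, d (p.2 i)) = n),
        (termSign ε p : ℝ) * b ^ (-(∑ i, v (p.1 i) i (p.2 i))) := by
  rw [coeff_det_patch b hb, Finset.sum_filter]

/-- **Weighted mass regrouping.** For `x ≥ 0`, a weight `φ ≥ 0` and any set `T` of exponents, the weighted coefficient
mass `Σ_{s ∈ T} φ(s) |a_s| x^s` of the patchworked determinant is at most the corresponding sum over the Leibniz TERMS of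
slope in `T`: `Σ_{D(p) ∈ T} φ(D p) |termSign p| b^{−V p} x^{D p}`. [folklore] -/
theorem weighted_mass_le_sum_terms (b : ℝ) (hb : 0 < b) (d : Fin K → ℕ) (v ε : Fin m → Fin m → Fin K → ℤ)
    (T : Finset ℕ) (φ : ℕ → ℝ) (hφ : ∀ s, 0 ≤ φ s) {x : ℝ} (hx : 0 ≤ x) :
    ∑ s ∈ T, φ s * |((∑ l, (X : ℝ[X]) ^ d l • (patchMatrix b v ε l).map C).det).coeff s| * x ^ s
      ≤ ∑ p ∈ (Finset.univ : Finset (Equiv.Perm (Fin m) × (Fin m → Fin K))).filter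
          (fun p => (∑ i, d (p.2 i)) ∈ T),
        φ (∑ i, d (p.2 i)) * |(termSign ε p : ℝ)| * b ^ (-(∑ i, v (p.1 i) i (p.2 i))) * x ^ (∑ i, d (p.2 i)) := by
  classical
  set F : Equiv.Perm (Fin m) × (Fin m → Fin K) → ℝ := fun p =>
    φ (∑ i, d (p.2 i)) * |(termSign ε p : ℝ)| * b ^ (-(∑ i, v (p.1 i) i (p.2 i))) * x ^ (∑ i, d (p.2 i)) with hF
  -- regroup the right-hand side by fibres of the slope map
  have hfib : ∑ p ∈ (Finset.univ : Finset (Equiv.Perm (Fin m) × (Fin m → Fin K))).filter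
      (fun p => (∑ i, d (p.2 i)) ∈ T), F p
      = ∑ s ∈ T, ∑ p ∈ (Finset.univ : Finset (Equiv.Perm (Fin m) × (Fin m → Fin K))).filter
          (fun p => (∑ i, d (p.2 i)) = s), F p := by
    rw [← Finset.sum_fiberwise_of_maps_to (s := (Finset.univ : Finset (Equiv.Perm (Fin m) × (Fin m → Fin K))).filter
      (fun p => (∑ i, d (p.2 i)) ∈ T)) (t := T) (g := fun p => ∑ i, d (p.2 i)) (fun p hp => (Finset.mem_filter.mp hp).2) F]
    refine Finset.sum_congr rfl fun s hs => Finset.sum_congr ?_ fun _ _ => rfl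
    ext p
    simp only [Finset.mem_filter, Finset.mem_univ, true_and]
    constructor
    · rintro ⟨_, h⟩; exact h
    · intro h; exact ⟨h ▸ hs, h⟩
  rw [hfib]
  refine Finset.sum_le_sum fun s hs => ?_
  -- the fibre over `s`
  rw [coeff_det_patch_eq_sum_filter b hb]
  have habs : |∑ p ∈ Finset.univ.filter (fun p : Equiv.Perm (Fin m) × (Fin m → Fin K) => (∑ i, d (p.2 i)) = s),
      (termSign ε p : ℝ) * b ^ (-(∑ i, v (p.1 i) i (p.2 i)))|
      ≤ ∑ p ∈ Finset.univ.filter (fun p : Equiv.Perm (Fin m) × (Fin m → Fin K) => (∑ i, d (p.2 i)) = s),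
        |(termSign ε p : ℝ)| * b ^ (-(∑ i, v (p.1 i) i (p.2 i))) := by
    refine (Finset.abs_sum_le_sum_abs _ _).trans (le_of_eq (Finset.sum_congr rfl fun p _ => ?_))
    rw [abs_mul, abs_of_pos (zpow_pos hb _)]
  calc φ s * |∑ p ∈ Finset.univ.filter (fun p : Equiv.Perm (Fin m) × (Fin m → Fin K) => (∑ i, d (p.2 i)) = s),
        (termSign ε p : ℝ) * b ^ (-(∑ i, v (p.1 i) i (p.2 i)))| * x ^ s
      ≤ φ s * (∑ p ∈ Finset.univ.filter (fun p : Equiv.Perm (Fin m) × (Fin m → Fin K) => (∑ i, d (p.2 i)) = s),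
        |(termSign ε p : ℝ)| * b ^ (-(∑ i, v (p.1 i) i (p.2 i)))) * x ^ s :=
        mul_le_mul_of_nonneg_right (mul_le_mul_of_nonneg_left habs (hφ s)) (pow_nonneg hx s)
    _ = ∑ p ∈ Finset.univ.filter (fun p : Equiv.Perm (Fin m) × (Fin m → Fin K) => (∑ i, d (p.2 i)) = s), F p := by
        rw [Finset.mul_sum, Finset.sum_mul]
        refine Finset.sum_congr rfl fun p hp => ?_
        have hps : (∑ i, d (p.2 i)) = s := (Finset.mem_filter.mp hp).2
        simp only [hF, hps]
        ring

/-- **The vertex coefficient.** If the present term `P` has strictly smaller valuation than every other present term of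
the same slope `w = D(P)`, then `|a_w − termSign(P)·b^{−V(P)}| ≤ (N − 1)·b^{−V(P)−1}` for `b ≥ 1`, `N` the number of
Leibniz terms. [folklore] -/
theorem abs_coeff_vertex_sub_le (b : ℝ) (hb : 1 ≤ b) (d : Fin K → ℕ) (v ε : Fin m → Fin m → Fin K → ℤ)
    (hε : ∀ i j l, (ε i j l).natAbs ≤ 1) (P : Equiv.Perm (Fin m) × (Fin m → Fin K))
    (huniq : ∀ Q : Equiv.Perm (Fin m) × (Fin m → Fin K), termSign ε Q ≠ 0 → Q ≠ P →
      (∑ i, d (Q.2 i)) = (∑ i, d (P.2 i)) → (∑ i, v (P.1 i) i (P.2 i)) + 1 ≤ ∑ i, v (Q.1 i) i (Q.2 i)) :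
    |((∑ l, (X : ℝ[X]) ^ d l • (patchMatrix b v ε l).map C).det).coeff (∑ i, d (P.2 i))
        - (termSign ε P : ℝ) * b ^ (-(∑ i, v (P.1 i) i (P.2 i)))|
      ≤ ((Fintype.card (Equiv.Perm (Fin m) × (Fin m → Fin K)) : ℝ) - 1) * b ^ (-(∑ i, v (P.1 i) i (P.2 i)) - 1) := by
  classical
  have hb0 : 0 < b := lt_of_lt_of_le one_pos hb
  set w := ∑ i, d (P.2 i) with hw
  set VP := ∑ i, v (P.1 i) i (P.2 i) with hVP
  set A := Finset.univ.filter (fun p : Equiv.Perm (Fin m) × (Fin m → Fin K) => (∑ i, d (p.2 i)) = w) with hA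
  have hPA : P ∈ A := by rw [hA]; exact Finset.mem_filter.mpr ⟨Finset.mem_univ _, rfl⟩
  rw [coeff_det_patch_eq_sum_filter b hb0, ← hA, ← Finset.add_sum_erase _ _ hPA, add_sub_cancel_left]
  have hterm : ∀ p ∈ A.erase P, |(termSign ε p : ℝ) * b ^ (-(∑ i, v (p.1 i) i (p.2 i)))| ≤ b ^ (-VP - 1) := by
    intro p hp
    obtain ⟨hpP, hpA⟩ := Finset.mem_erase.mp hp
    by_cases hz : termSign ε p = 0
    · rw [hz, Int.cast_zero, zero_mul, abs_zero]; exact le_of_lt (zpow_pos hb0 _)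
    · rw [abs_mul, abs_termSign_eq_one ε hε p hz, one_mul, abs_of_pos (zpow_pos hb0 _)]
      have hD : (∑ i, d (p.2 i)) = w := (Finset.mem_filter.mp hpA).2
      have hV := huniq p hz hpP hD
      exact zpow_le_zpow_right₀ hb (by omega)
  calc |∑ p ∈ A.erase P, (termSign ε p : ℝ) * b ^ (-(∑ i, v (p.1 i) i (p.2 i)))|
      ≤ ∑ p ∈ A.erase P, |(termSign ε p : ℝ) * b ^ (-(∑ i, v (p.1 i) i (p.2 i)))| := Finset.abs_sum_le_sum_abs _ _
    _ ≤ ∑ _p ∈ A.erase P, b ^ (-VP - 1) := Finset.sum_le_sum hterm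
    _ = ((A.erase P).card : ℝ) * b ^ (-VP - 1) := by rw [Finset.sum_const, nsmul_eq_mul]
    _ ≤ ((Fintype.card (Equiv.Perm (Fin m) × (Fin m → Fin K)) : ℝ) - 1) * b ^ (-VP - 1) := by
        refine mul_le_mul_of_nonneg_right ?_ (le_of_lt (zpow_pos hb0 _))
        have h1 : (A.erase P).card = A.card - 1 := Finset.card_erase_of_mem hPA
        have h2 : A.card ≤ Fintype.card (Equiv.Perm (Fin m) × (Fin m → Fin K)) := Finset.card_le_univ _
        have h3 : 1 ≤ A.card := Finset.card_pos.mpr ⟨P, hPA⟩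
        have : ((A.erase P).card : ℝ) = (A.card : ℝ) - 1 := by
          rw [h1, Nat.cast_sub h3, Nat.cast_one]
        rw [this]
        have : (A.card : ℝ) ≤ Fintype.card (Equiv.Perm (Fin m) × (Fin m → Fin K)) := by exact_mod_cast h2
        linarith

/-- **Term mass at a test point.** For `x = b^θ · ρ`: `b^{−V(p)} x^{D(p)} = b^{tropWeight θ p} · ρ^{D(p)}`. [folklore] -/
theorem zpow_neg_mul_pow_eq (b : ℝ) (hb : 0 < b) (d : Fin K → ℕ) (v : Fin m → Fin m → Fin K → ℤ)
    (θ : ℤ) (ρ : ℝ) (p : Equiv.Perm (Fin m) × (Fin m → Fin K)) :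
    b ^ (-(∑ i, v (p.1 i) i (p.2 i))) * (b ^ θ * ρ) ^ (∑ i, d (p.2 i))
      = b ^ tropWeight d v θ p * ρ ^ (∑ i, d (p.2 i)) := by
  have hb0 : b ≠ 0 := ne_of_gt hb
  unfold tropWeight
  rw [mul_pow, ← zpow_natCast (b ^ θ), ← zpow_mul, zpow_sub₀ hb0, zpow_neg]
  push_cast
  ring


/-- a competitor's term at the test point `x = b^θ ρ₀`: if it is absent or its weight is `≤ W − 1`, its weighted mass is
`≤ φ₀ · b^{W−1} · c` whenever `ρ₀^{D} ≤ c`. [folklore] -/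
theorem term_mass_le (b : ℝ) (hb : 1 ≤ b) (d : Fin K → ℕ) (v ε : Fin m → Fin m → Fin K → ℤ)
    (hε : ∀ i j l, (ε i j l).natAbs ≤ 1) (θ W : ℤ) {ρ₀ c φ₀ : ℝ} (hρ : 0 < ρ₀) (hφ : 0 ≤ φ₀)
    (p : Equiv.Perm (Fin m) × (Fin m → Fin K)) (hc : ρ₀ ^ (∑ i, d (p.2 i)) ≤ c)
    (hw : termSign ε p = 0 ∨ tropWeight d v θ p ≤ W - 1) :
    φ₀ * |(termSign ε p : ℝ)| * b ^ (-(∑ i, v (p.1 i) i (p.2 i))) * (b ^ θ * ρ₀) ^ (∑ i, d (p.2 i))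
      ≤ φ₀ * b ^ (W - 1) * c := by
  have hb0 : 0 < b := lt_of_lt_of_le one_pos hb
  have hc0 : 0 ≤ c := le_trans (pow_nonneg hρ.le _) hc
  rcases hw with hz | hle
  · rw [hz, Int.cast_zero, abs_zero, mul_zero, zero_mul, zero_mul]
    exact mul_nonneg (mul_nonneg hφ (zpow_pos hb0 _).le) hc0
  · by_cases hz : termSign ε p = 0
    · rw [hz, Int.cast_zero, abs_zero, mul_zero, zero_mul, zero_mul]
      exact mul_nonneg (mul_nonneg hφ (zpow_pos hb0 _).le) hc0
    rw [abs_termSign_eq_one ε hε p hz, mul_one, mul_assoc, zpow_neg_mul_pow_eq b hb0 d v θ ρ₀ p, ← mul_assoc]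
    exact mul_le_mul (mul_le_mul_of_nonneg_left (zpow_le_zpow_right₀ hb hle) hφ) hc (pow_nonneg hρ.le _)
      (mul_nonneg hφ (zpow_pos hb0 _).le)

/-- the mass of a present term of weight `W` at `x = b^θ ρ₀` is `b^W ρ₀^D`. [folklore] -/
theorem term_mass_eq (b : ℝ) (hb : 0 < b) (d : Fin K → ℕ) (v ε : Fin m → Fin m → Fin K → ℤ)
    (hε : ∀ i j l, (ε i j l).natAbs ≤ 1) (θ : ℤ) (ρ₀ : ℝ)
    (p : Equiv.Perm (Fin m) × (Fin m → Fin K)) (hp : termSign ε p ≠ 0) :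
    |(termSign ε p : ℝ)| * b ^ (-(∑ i, v (p.1 i) i (p.2 i))) * (b ^ θ * ρ₀) ^ (∑ i, d (p.2 i))
      = b ^ tropWeight d v θ p * ρ₀ ^ (∑ i, d (p.2 i)) := by
  rw [abs_termSign_eq_one ε hε p hp, one_mul, zpow_neg_mul_pow_eq b hb d v θ ρ₀ p]

/-- **Mass bound at a test point.** At `x = b^θ ρ₀`, if every present term of slope in `T` other than `p₀ ∈ A` has weight
`≤ W − 1`, `p₀` (present) has weight `W`, the weights satisfy `0 ≤ φ ≤ Φ` on slopes in `T` and `ρ₀^{D} ≤ c` for all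
terms, then `Σ_{s ∈ T} φ(s)|a_s| x^s ≤ φ(D p₀) b^W ρ₀^{D p₀} + N Φ b^{W−1} c`. [folklore] -/
theorem mass_le_vertex_add (b : ℝ) (hb : 1 ≤ b) (d : Fin K → ℕ) (v ε : Fin m → Fin m → Fin K → ℤ)
    (hε : ∀ i j l, (ε i j l).natAbs ≤ 1) (θ W : ℤ) {ρ₀ c Φ : ℝ} (hρ : 0 < ρ₀) (T : Finset ℕ) (φ : ℕ → ℝ)
    (hφ : ∀ s, 0 ≤ φ s) (hΦ : 0 ≤ Φ) (hφΦ : ∀ s ∈ T, φ s ≤ Φ) (hc : ∀ p : Equiv.Perm (Fin m) × (Fin m → Fin K),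
      termSign ε p ≠ 0 → ρ₀ ^ (∑ i, d (p.2 i)) ≤ c) (hc0 : 0 ≤ c)
    (p₀ : Equiv.Perm (Fin m) × (Fin m → Fin K)) (hp₀ : termSign ε p₀ ≠ 0) (hW : tropWeight d v θ p₀ = W)
    (hmar : ∀ p : Equiv.Perm (Fin m) × (Fin m → Fin K), termSign ε p ≠ 0 → p ≠ p₀ → (∑ i, d (p.2 i)) ∈ T →
      tropWeight d v θ p ≤ W - 1) :
    ∑ s ∈ T, φ s * |((∑ l, (X : ℝ[X]) ^ d l • (patchMatrix b v ε l).map C).det).coeff s| * (b ^ θ * ρ₀) ^ s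
      ≤ φ (∑ i, d (p₀.2 i)) * (b ^ W * ρ₀ ^ (∑ i, d (p₀.2 i)))
        + (Fintype.card (Equiv.Perm (Fin m) × (Fin m → Fin K)) : ℝ) * (Φ * b ^ (W - 1) * c) := by
  classical
  have hb0 : 0 < b := lt_of_lt_of_le one_pos hb
  have hx : 0 ≤ b ^ θ * ρ₀ := (mul_pos (zpow_pos hb0 _) hρ).le
  refine (weighted_mass_le_sum_terms b hb0 d v ε T φ hφ hx).trans ?_
  set A := (Finset.univ : Finset (Equiv.Perm (Fin m) × (Fin m → Fin K))).filter
      (fun p => (∑ i, d (p.2 i)) ∈ T) with hA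
  set F : Equiv.Perm (Fin m) × (Fin m → Fin K) → ℝ := fun p =>
    φ (∑ i, d (p.2 i)) * |(termSign ε p : ℝ)| * b ^ (-(∑ i, v (p.1 i) i (p.2 i))) * (b ^ θ * ρ₀) ^ (∑ i, d (p.2 i))
    with hF
  have hFnn : ∀ p, 0 ≤ F p := fun p =>
    mul_nonneg (mul_nonneg (mul_nonneg (hφ _) (abs_nonneg _)) (zpow_pos hb0 _).le) (pow_nonneg hx _)
  -- every term other than `p₀` is small
  have hsmall : ∀ p ∈ A.erase p₀, F p ≤ Φ * b ^ (W - 1) * c := by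
    intro p hp
    obtain ⟨hpp, hpA⟩ := Finset.mem_erase.mp hp
    have hT : (∑ i, d (p.2 i)) ∈ T := (Finset.mem_filter.mp hpA).2
    by_cases hz : termSign ε p = 0
    · simp only [hF, hz, Int.cast_zero, abs_zero, mul_zero, zero_mul]
      exact mul_nonneg (mul_nonneg ((hφ _).trans (hφΦ _ hT)) (zpow_pos hb0 _).le) hc0
    · calc F p ≤ φ (∑ i, d (p.2 i)) * b ^ (W - 1) * c :=
            term_mass_le b hb d v ε hε θ W hρ (hφ _) p (hc p hz) (Or.inr (hmar p hz hpp hT))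
        _ ≤ Φ * b ^ (W - 1) * c :=
            mul_le_mul_of_nonneg_right (mul_le_mul_of_nonneg_right (hφΦ _ hT) (zpow_pos hb0 _).le) hc0
  have hrest : ∑ p ∈ A.erase p₀, F p ≤ (Fintype.card (Equiv.Perm (Fin m) × (Fin m → Fin K)) : ℝ) * (Φ * b ^ (W - 1) * c) := by
    calc ∑ p ∈ A.erase p₀, F p ≤ ∑ _p ∈ A.erase p₀, Φ * b ^ (W - 1) * c := Finset.sum_le_sum hsmall
      _ = ((A.erase p₀).card : ℝ) * (Φ * b ^ (W - 1) * c) := by rw [Finset.sum_const, nsmul_eq_mul]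
      _ ≤ (Fintype.card (Equiv.Perm (Fin m) × (Fin m → Fin K)) : ℝ) * (Φ * b ^ (W - 1) * c) := by
          refine mul_le_mul_of_nonneg_right ?_ (mul_nonneg (mul_nonneg hΦ (zpow_pos hb0 _).le) hc0)
          exact_mod_cast (Finset.card_le_univ (A.erase p₀))
  have hp0val : F p₀ = φ (∑ i, d (p₀.2 i)) * (b ^ W * ρ₀ ^ (∑ i, d (p₀.2 i))) := by
    have : F p₀ = φ (∑ i, d (p₀.2 i)) * (|(termSign ε p₀ : ℝ)| * b ^ (-(∑ i, v (p₀.1 i) i (p₀.2 i)))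
        * (b ^ θ * ρ₀) ^ (∑ i, d (p₀.2 i))) := by simp only [hF]; ring
    rw [this, term_mass_eq b hb0 d v ε hε θ ρ₀ p₀ hp₀, hW]
  have hfirst : 0 ≤ φ (∑ i, d (p₀.2 i)) * (b ^ W * ρ₀ ^ (∑ i, d (p₀.2 i))) :=
    mul_nonneg (hφ _) (mul_nonneg (zpow_pos hb0 _).le (pow_nonneg hρ.le _))
  show ∑ p ∈ A, F p ≤ _
  by_cases hmem : p₀ ∈ A
  · rw [← Finset.add_sum_erase _ _ hmem, hp0val]
    exact add_le_add_right hrest _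
  · rw [← Finset.erase_eq_of_notMem hmem]
    exact hrest.trans (le_add_of_nonneg_left hfirst)


/-- **Mass bound with no vertex term.** At `x = b^θ ρ₀`, if EVERY present term of slope in `T` has weight `≤ W − 1`, then
`Σ_{s ∈ T} φ(s)|a_s| x^s ≤ N Φ b^{W−1} c`. [folklore] -/
theorem mass_le_of_margin (b : ℝ) (hb : 1 ≤ b) (d : Fin K → ℕ) (v ε : Fin m → Fin m → Fin K → ℤ)
    (hε : ∀ i j l, (ε i j l).natAbs ≤ 1) (θ W : ℤ) {ρ₀ c Φ : ℝ} (hρ : 0 < ρ₀) (T : Finset ℕ) (φ : ℕ → ℝ)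
    (hφ : ∀ s, 0 ≤ φ s) (hΦ : 0 ≤ Φ) (hφΦ : ∀ s ∈ T, φ s ≤ Φ) (hc : ∀ p : Equiv.Perm (Fin m) × (Fin m → Fin K),
      termSign ε p ≠ 0 → ρ₀ ^ (∑ i, d (p.2 i)) ≤ c) (hc0 : 0 ≤ c)
    (hmar : ∀ p : Equiv.Perm (Fin m) × (Fin m → Fin K), termSign ε p ≠ 0 → (∑ i, d (p.2 i)) ∈ T →
      tropWeight d v θ p ≤ W - 1) :
    ∑ s ∈ T, φ s * |((∑ l, (X : ℝ[X]) ^ d l • (patchMatrix b v ε l).map C).det).coeff s| * (b ^ θ * ρ₀) ^ s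
      ≤ (Fintype.card (Equiv.Perm (Fin m) × (Fin m → Fin K)) : ℝ) * (Φ * b ^ (W - 1) * c) := by
  classical
  have hb0 : 0 < b := lt_of_lt_of_le one_pos hb
  have hx : 0 ≤ b ^ θ * ρ₀ := (mul_pos (zpow_pos hb0 _) hρ).le
  refine (weighted_mass_le_sum_terms b hb0 d v ε T φ hφ hx).trans ?_
  set A := (Finset.univ : Finset (Equiv.Perm (Fin m) × (Fin m → Fin K))).filter
      (fun p => (∑ i, d (p.2 i)) ∈ T) with hA
  set F : Equiv.Perm (Fin m) × (Fin m → Fin K) → ℝ := fun p =>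
    φ (∑ i, d (p.2 i)) * |(termSign ε p : ℝ)| * b ^ (-(∑ i, v (p.1 i) i (p.2 i))) * (b ^ θ * ρ₀) ^ (∑ i, d (p.2 i))
    with hF
  have hsmall : ∀ p ∈ A, F p ≤ Φ * b ^ (W - 1) * c := by
    intro p hpA
    have hT : (∑ i, d (p.2 i)) ∈ T := (Finset.mem_filter.mp hpA).2
    by_cases hz : termSign ε p = 0
    · simp only [hF, hz, Int.cast_zero, abs_zero, mul_zero, zero_mul]
      exact mul_nonneg (mul_nonneg ((hφ _).trans (hφΦ _ hT)) (zpow_pos hb0 _).le) hc0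
    · calc F p ≤ φ (∑ i, d (p.2 i)) * b ^ (W - 1) * c :=
            term_mass_le b hb d v ε hε θ W hρ (hφ _) p (hc p hz) (Or.inr (hmar p hz hT))
        _ ≤ Φ * b ^ (W - 1) * c :=
            mul_le_mul_of_nonneg_right (mul_le_mul_of_nonneg_right (hφΦ _ hT) (zpow_pos hb0 _).le) hc0
  show ∑ p ∈ A, F p ≤ _
  calc ∑ p ∈ A, F p ≤ ∑ _p ∈ A, Φ * b ^ (W - 1) * c := Finset.sum_le_sum hsmall
    _ = (A.card : ℝ) * (Φ * b ^ (W - 1) * c) := by rw [Finset.sum_const, nsmul_eq_mul]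
    _ ≤ (Fintype.card (Equiv.Perm (Fin m) × (Fin m → Fin K)) : ℝ) * (Φ * b ^ (W - 1) * c) := by
        refine mul_le_mul_of_nonneg_right ?_ (mul_nonneg (mul_nonneg hΦ (zpow_pos hb0 _).le) hc0)
        exact_mod_cast (Finset.card_le_univ A)

/-- every exponent in the support of the patchworked determinant is the slope of a PRESENT term. [folklore] -/
theorem exists_present_of_mem_support (b : ℝ) (hb : 0 < b) (d : Fin K → ℕ) (v ε : Fin m → Fin m → Fin K → ℤ)
    {s : ℕ} (hs : s ∈ ((∑ l, (X : ℝ[X]) ^ d l • (patchMatrix b v ε l).map C).det).support) :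
    ∃ p : Equiv.Perm (Fin m) × (Fin m → Fin K), termSign ε p ≠ 0 ∧ (∑ i, d (p.2 i)) = s := by
  classical
  by_contra hcon
  push Not at hcon
  rw [Polynomial.mem_support_iff, coeff_det_patch_eq_sum_filter b hb] at hs
  refine hs (Finset.sum_eq_zero fun p hp => ?_)
  have hD : (∑ i, d (p.2 i)) = s := (Finset.mem_filter.mp hp).2
  by_cases hz : termSign ε p = 0
  · rw [hz, Int.cast_zero, zero_mul]
  · exact absurd hD (hcon p hz)

/-- **The vertex coefficient has the sign of its term and at least half its size** (`b ≥ 2N`). [folklore] -/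
theorem half_le_termSign_mul_coeff (b : ℝ) (d : Fin K → ℕ) (v ε : Fin m → Fin m → Fin K → ℤ)
    (hε : ∀ i j l, (ε i j l).natAbs ≤ 1) (P : Equiv.Perm (Fin m) × (Fin m → Fin K)) (hP : termSign ε P ≠ 0)
    (huniq : ∀ Q : Equiv.Perm (Fin m) × (Fin m → Fin K), termSign ε Q ≠ 0 → Q ≠ P →
      (∑ i, d (Q.2 i)) = (∑ i, d (P.2 i)) → (∑ i, v (P.1 i) i (P.2 i)) + 1 ≤ ∑ i, v (Q.1 i) i (Q.2 i))
    (hbN : 2 * (Fintype.card (Equiv.Perm (Fin m) × (Fin m → Fin K)) : ℝ) ≤ b) :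
    b ^ (-(∑ i, v (P.1 i) i (P.2 i))) / 2
      ≤ (termSign ε P : ℝ) * ((∑ l, (X : ℝ[X]) ^ d l • (patchMatrix b v ε l).map C).det).coeff (∑ i, d (P.2 i)) := by
  set N : ℝ := (Fintype.card (Equiv.Perm (Fin m) × (Fin m → Fin K)) : ℝ) with hN
  have hN1 : (1 : ℝ) ≤ N := by
    rw [hN]; exact_mod_cast Fintype.card_pos_iff.mpr ⟨P⟩
  have hb1 : 1 ≤ b := by linarith
  have hb0 : 0 < b := lt_of_lt_of_le one_pos hb1
  set VP := ∑ i, v (P.1 i) i (P.2 i) with hVP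
  set a := ((∑ l, (X : ℝ[X]) ^ d l • (patchMatrix b v ε l).map C).det).coeff (∑ i, d (P.2 i)) with ha
  have hE := abs_coeff_vertex_sub_le b hb1 d v ε hε P huniq
  rw [← ha, ← hVP] at hE
  have ht1 : |(termSign ε P : ℝ)| = 1 := abs_termSign_eq_one ε hε P hP
  have hsq : (termSign ε P : ℝ) * (termSign ε P : ℝ) = 1 := by
    nlinarith [abs_mul_abs_self (termSign ε P : ℝ), ht1]
  -- `tS · a = b^{−V} + tS · (a − tS b^{−V})`
  have hsplit : (termSign ε P : ℝ) * a = b ^ (-VP) + (termSign ε P : ℝ) * (a - (termSign ε P : ℝ) * b ^ (-VP)) := by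
    have : (termSign ε P : ℝ) * ((termSign ε P : ℝ) * b ^ (-VP)) = b ^ (-VP) := by
      rw [← mul_assoc, hsq, one_mul]
    rw [mul_sub, this]; ring
  have hbound : |(termSign ε P : ℝ) * (a - (termSign ε P : ℝ) * b ^ (-VP))| ≤ (N - 1) * b ^ (-VP - 1) := by
    rw [abs_mul, ht1, one_mul]; exact hE
  have hneg := neg_abs_le ((termSign ε P : ℝ) * (a - (termSign ε P : ℝ) * b ^ (-VP)))
  -- `(N − 1) b^{−V−1} ≤ b^{−V}/2` since `2(N−1) ≤ b`
  have hstep : (N - 1) * b ^ (-VP - 1) ≤ b ^ (-VP) / 2 := by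
    have h1 : b ^ (-VP - 1) = b ^ (-VP) * b⁻¹ := by
      rw [sub_eq_add_neg, zpow_add₀ hb0.ne', zpow_neg_one]
    rw [h1]
    have hpos : 0 < b ^ (-VP) := zpow_pos hb0 _
    have h2 : (N - 1) * b⁻¹ ≤ 1 / 2 := by
      rw [mul_inv_le_iff₀ hb0]; linarith
    calc (N - 1) * (b ^ (-VP) * b⁻¹) = b ^ (-VP) * ((N - 1) * b⁻¹) := by ring
      _ ≤ b ^ (-VP) * (1 / 2) := mul_le_mul_of_nonneg_left h2 hpos.le
      _ = b ^ (-VP) / 2 := by ring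
  rw [hsplit]
  linarith

end Summit.ValiantsHypothesis.ValiantsHypothesis.Theorems.KPlusLogSqLaw.ExactPatchwork
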